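import Mathlib
import Summits.Ventures.PercRepro.TriangleCapTriangleFreeSparse

/-!
# PercRepro — THE TRIANGLE-FREE CHERRY TABLE BELOW THE DENSE CORNER, THE EQUALITY LOCUS: on the row `a = 2`
the extremal triangle-free graphs are exactly `K_{2,k−2}` minus a star (p3, gen 42; part 180)

Part 179 proved `Σ_v d(v)² + r (k − 1 − r) ≤ m k` for triangle-free graphs with `m = 2(k−2) − r` edges,
`4 + r ≤ k`.  Here the equality case (`cliqueFree_sparse_locus`): equality holds iff the graph is a spanning
subgraph of some `K_{2,k−2}` whose `r` missing cross pairs form a star (`BipSub D A ∧ MissingStar D A v`,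
`|A| = 2`).  The proof is part 168's degree argument at equality on the row `a = 2`: every degree `≥ 2` forces
`r = 0` and Mantel's equality (`complete_bipartite_of_mantel_eq`) gives `K_{2,k−2}`; a vertex of degree `≤ 1`
deleted across the row is strictly below the bound (`band_of_low_degree_cross_env_strict`); deleted within
the row it is tight only with its neighbour at the cap `k − 2` and `D − z` extremal one cell down
(`band_of_low_degree_eq`), so `D − z ≤ K_{2,k−3}` by induction and the side of the neighbour carries
`D ≤ K_{2,k−2}` (`bipSub_two_of_del`: the neighbour has degree `k − 3` in `D − z`, hence lies on the small side
when `k ≥ 6`, and on a side of size `2` when `k = 5`); the star then comes from the bipartite sub-problem's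
equality clause (`exists_missingStar_of_closed_form_eq`).  Axioms: standard.
-/

namespace PercRepro

namespace TriangleCap

namespace C047

open Finset

universe u

variable {V : Type*} [Fintype V] [DecidableEq V]

/-- **ACROSS THE ROW, STRICTLY, WITH THE ENVELOPE SUPPLIED:** `r + d(z) ≤ a − 1`, the cap, and `Σ d² ≤ m' (k − 1)`
on `D − z` ⇒ `Σ_v d(v)² + r (k − 1 − r) + 1 ≤ m k`. -/
theorem band_of_low_degree_cross_env_strict (D : SimpleGraph V) [DecidableRel D.Adj] (a r : ℕ)
    (hcap : ∀ v, deg D v + a ≤ Fintype.card V) {z : V} (hrd : r + deg D z + 1 ≤ a)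
    (hk : r + 2 * a ≤ Fintype.card V) (hm : D.edgeFinset.card + a * a + r = a * Fintype.card V)
    (henv : ∑ v, deg (del D z) v * deg (del D z) v ≤ (del D z).edgeFinset.card * Fintype.card {v : V // v ≠ z}) :
    ∑ v, deg D v * deg D v + r * (Fintype.card V - 1 - r) + 1 ≤ D.edgeFinset.card * Fintype.card V := by
  have hcard := card_del z
  have hedges := card_edges_del D z
  have hsq := sum_deg_sq_del D z
  have hT := sum_del_nbhd_le D z (Fintype.card V - a - 1) (fun v => by have := hcap v; omega)
  obtain ⟨k', hk'⟩ : ∃ k', Fintype.card {v : V // v ≠ z} = k' := ⟨_, rfl⟩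
  obtain ⟨m', hm'⟩ : ∃ m', (del D z).edgeFinset.card = m' := ⟨_, rfl⟩
  obtain ⟨d, hdz⟩ : ∃ d, deg D z = d := ⟨_, rfl⟩
  obtain ⟨T, hTT⟩ : ∃ T, ∑ a : {v : V // v ≠ z}, (if D.Adj a.1 z then deg (del D z) a else 0) = T := ⟨_, rfl⟩
  obtain ⟨S, hS⟩ : ∃ S, ∑ v, deg (del D z) v * deg (del D z) v = S := ⟨_, rfl⟩
  rw [hk'] at hcard henv
  rw [hm'] at hedges henv
  rw [hdz] at hedges hsq hT hrd
  rw [hTT] at hsq hT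
  rw [hS] at hsq henv
  have hkV : Fintype.card V = k' + 1 := by omega
  have hmD : D.edgeFinset.card = m' + d := by omega
  rw [hkV, hmD]
  rw [hkV] at hm hT hk
  rw [hmD] at hm
  rw [hsq]
  obtain ⟨t, rfl⟩ : ∃ t, a = r + d + 1 + t := ⟨a - (r + d + 1), by omega⟩
  obtain ⟨j, rfl⟩ : ∃ j, k' = 3 * r + 2 * d + 1 + 2 * t + j := ⟨k' - (3 * r + 2 * d + 1 + 2 * t), by omega⟩
  have e3 : 3 * r + 2 * d + 1 + 2 * t + j + 1 - 1 - r = 2 * r + 2 * d + 1 + 2 * t + j := by omega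
  have e4 : 3 * r + 2 * d + 1 + 2 * t + j + 1 - (r + d + 1 + t) - 1 = 2 * r + d + t + j := by omega
  rw [e3]
  rw [e4] at hT
  have := band_low_degree_cross_arith_strict r d t j S T m' henv hT hm
  linarith

/-- **TRANSPORT OF A TWO-SIDE ALONG THE DELETION OF A VERTEX OF DEGREE `≤ 1`:** if `D − z ≤ K(A', A'ᶜ)` with
`|A'| = 2` and the neighbour of `z` (if any) has degree `k − 2` in `D`, then `D ≤ K(A, Aᶜ)` for some `|A| = 2`:
the neighbour has degree `k − 3` in `D − z`, which puts it on the small side when `k ≥ 6` and on a side of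
size two when `k = 5`. -/
theorem bipSub_two_of_del (D : SimpleGraph V) [DecidableRel D.Adj] (z : V) (hz : deg D z ≤ 1) (r : ℕ)
    (hr : 1 ≤ r) (hk : 4 + r ≤ Fintype.card V) (A' : Finset {v : V // v ≠ z}) (hA' : A'.card = 2)
    (hsub' : BipSub (del D z) A')
    (hnb : ∀ x : {v : V // v ≠ z}, D.Adj x.1 z → deg D x.1 + 2 = Fintype.card V) :
    ∃ A : Finset V, A.card = 2 ∧ BipSub D A := by
  have hcard := card_del z
  by_cases hall : ∀ x : {v : V // v ≠ z}, D.Adj x.1 z → x ∈ A'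
  · obtain ⟨A, hA, hsub⟩ := bipSub_lift D z A' hsub' hall
    exact ⟨A, hA.trans hA', hsub⟩
  · push Not at hall
    obtain ⟨x, hxz, hxA⟩ := hall
    -- `x` has degree `k − 3` in `D − z`, at most `|A'| = 2` off `A'`: `k = 5`, and `A'ᶜ` has two elements
    have h1 := deg_del D z x
    rw [if_pos hxz] at h1
    have h2 := hnb x hxz
    have h3 := deg_le_card_of_bipSub (del D z) A' hsub' x hxA
    have hk5 : Fintype.card V = 5 := by omega
    have hcompl : (A'ᶜ).card = 2 := by
      rw [card_compl, hA']
      omega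
    -- every neighbour of `z` is `x` (degree `≤ 1`), and `x ∈ A'ᶜ`
    have honly : ∀ y : {v : V // v ≠ z}, D.Adj y.1 z → y = x := by
      intro y hyz
      by_contra hyx
      have hsub2 : ({x, y} : Finset {v : V // v ≠ z}).map (Function.Embedding.subtype _) ⊆
          univ.filter (fun w => D.Adj z w) := by
        intro w hw
        rw [mem_map] at hw
        obtain ⟨u, hu, rfl⟩ := hw
        simp only [mem_insert, mem_singleton] at hu
        rw [mem_filter]
        rcases hu with rfl | rfl
        · exact ⟨mem_univ _, D.adj_symm hxz⟩
        · exact ⟨mem_univ _, D.adj_symm hyz⟩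
      have := card_le_card hsub2
      rw [card_map, card_pair (Ne.symm hyx)] at this
      unfold deg at hz
      omega
    obtain ⟨A, hA, hsub⟩ := bipSub_lift D z A'ᶜ (bipSub_compl (del D z) A' hsub')
      (fun y hyz => by rw [honly y hyz]; exact mem_compl.mpr hxA)
    exact ⟨A, hA.trans hcompl, hsub⟩

/-- **THE LOCUS ON THE ROW `a = 2`, THE BIPARTITE HALF, ONE STEP:** an extremal triangle-free graph of the row is
a spanning subgraph of some `K_{2,k−2}`, given the same for the deleted graphs one cell down. -/
theorem cliqueFree_sparse_bipSub_step (D : SimpleGraph V) [DecidableRel D.Adj] (hfree : D.CliqueFree 3) (r : ℕ)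
    (hk : 4 + r ≤ Fintype.card V) (hm : D.edgeFinset.card + 2 * 2 + r = 2 * Fintype.card V)
    (heq : ∑ v, deg D v * deg D v + r * (Fintype.card V - 1 - r) = D.edgeFinset.card * Fintype.card V)
    (hdel : ∀ z : V, deg D z + 1 ≤ 2 → 2 ≤ r + deg D z →
      ∑ v, deg (del D z) v * deg (del D z) v +
          (r + deg D z - 2) * (Fintype.card {v : V // v ≠ z} - 1 - (r + deg D z - 2)) =
        (del D z).edgeFinset.card * Fintype.card {v : V // v ≠ z} →
      ∃ A' : Finset {v : V // v ≠ z}, A'.card = 2 ∧ BipSub (del D z) A') :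
    ∃ A : Finset V, A.card = 2 ∧ BipSub D A := by
  have hcap : ∀ v, deg D v + 2 ≤ Fintype.card V := deg_add_two_le_of_cliqueFree D hfree (by omega)
  by_cases hdeg : ∀ z, 2 ≤ deg D z
  · -- every degree `≥ 2`: `r = 0`, Mantel's equality, `K_{2,k−2}`
    have h1 := band_stability_of_min_degree_strict D 2 r hcap hdeg (by omega) hm
    have hr0 : r = 0 := by
      by_contra hr
      have : r * (Fintype.card V - 1 - r) < r * Fintype.card V :=
        Nat.mul_lt_mul_of_pos_left (by omega) (by omega)
      omega
    subst hr0
    simp only [zero_mul, add_zero] at heq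
    obtain ⟨A, hA⟩ := complete_bipartite_of_mantel_eq D hfree (by omega) heq
    have hsub := bipSub_of_xor D A hA
    have hE := card_edges_eq_of_complete_bipartite D A hA
    rcases eq_or_eq_of_mul_sub_eq A.card 2 (Fintype.card V) (card_le_univ A) (by omega) (by omega) with h | h
    · exact ⟨A, h, hsub⟩
    · exact ⟨Aᶜ, by rw [card_compl]; omega, bipSub_compl D A hsub⟩
  · push Not at hdeg
    obtain ⟨z, hz⟩ := hdeg
    have hfree' := cliqueFree_del D hfree z
    rcases Nat.lt_or_ge (r + deg D z) 2 with hcross | hwithin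
    · exfalso
      have := band_of_low_degree_cross_env_strict D 2 r hcap (z := z) (by omega) (by omega) hm
        (sum_deg_sq_le_of_cliqueFree (del D z) hfree')
      omega
    · have hcard' := card_del z
      have hedges' := card_edges_del D z
      have hm' : (del D z).edgeFinset.card + 2 * 2 + (r + deg D z - 2) = 2 * Fintype.card {v : V // v ≠ z} := by
        omega
      have hrow := cliqueFree_sparse_stability (del D z) hfree' (r + deg D z - 2) (by omega) hm'
      obtain ⟨-, hnb, heq'⟩ :=
        band_of_low_degree_eq D 2 r hcap (z := z) (by omega) hwithin (by omega) hm hrow heq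
      obtain ⟨A', hA', hsub'⟩ := hdel z (by omega) hwithin heq'
      exact bipSub_two_of_del D z (by omega) r (by omega) hk A' hA' hsub' hnb

/-- **THE LOCUS ON THE ROW `a = 2`, THE BIPARTITE HALF, BY INDUCTION ON `k`.** -/
theorem cliqueFree_sparse_bipSub_aux (n : ℕ) :
    ∀ (W : Type u) [Fintype W] [DecidableEq W] (D : SimpleGraph W) [DecidableRel D.Adj],
      Fintype.card W = n + 4 → D.CliqueFree 3 →
      ∀ r, 4 + r ≤ Fintype.card W → D.edgeFinset.card + 2 * 2 + r = 2 * Fintype.card W →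
      ∑ v, deg D v * deg D v + r * (Fintype.card W - 1 - r) = D.edgeFinset.card * Fintype.card W →
      ∃ A : Finset W, A.card = 2 ∧ BipSub D A := by
  induction n with
  | zero =>
    intro W _ _ D _ hcard hfree r hk hm heq
    refine cliqueFree_sparse_bipSub_step D hfree r hk hm heq (fun z hz hwithin _ => ?_)
    exfalso
    omega
  | succ n ih =>
    intro W _ _ D _ hcard hfree r hk hm heq
    refine cliqueFree_sparse_bipSub_step D hfree r hk hm heq (fun z hz hwithin heq' => ?_)
    have hcard' := card_del z
    have hedges' := card_edges_del D z
    exact ih {v : W // v ≠ z} (del D z) (by omega) (cliqueFree_del D hfree z) (r + deg D z - 2) (by omega)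
      (by omega) heq'

/-- **THE EQUALITY LOCUS ON THE ROW `a = 2` OF THE TRIANGLE-FREE CHERRY TABLE:** a triangle-free graph on `k`
vertices with `2(k−2) − r` edges, `4 + r ≤ k`, has `Σ_v d(v)² + r (k − 1 − r) = m k` iff it is `K_{2,k−2}` minus
a star of `r` edges at one vertex. -/
theorem cliqueFree_sparse_locus (D : SimpleGraph V) [DecidableRel D.Adj] (hfree : D.CliqueFree 3) (r : ℕ)
    (hk : 4 + r ≤ Fintype.card V) (hm : D.edgeFinset.card + 2 * 2 + r = 2 * Fintype.card V) :
    ∑ v, deg D v * deg D v + r * (Fintype.card V - 1 - r) = D.edgeFinset.card * Fintype.card V ↔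
      ∃ (A : Finset V) (v : V), A.card = 2 ∧ BipSub D A ∧ MissingStar D A v := by
  have hcell : D.edgeFinset.card + r = 2 * (Fintype.card V - 2) := cell_edges 2 r _ _ hm (by omega)
  constructor
  · intro heq
    obtain ⟨A, hA, hsub⟩ := cliqueFree_sparse_bipSub_aux (Fintype.card V - 4) V D (by omega) hfree r hk hm heq
    obtain ⟨v, hv⟩ := exists_missingStar_of_closed_form_eq D A hsub 2 r hA hcell (by omega) heq
    exact ⟨A, v, hA, hsub, hv⟩
  · rintro ⟨A, v, hA, hsub, hv⟩
    exact closed_form_eq_of_missingStar D A hsub hv 2 r hA hcell (by omega)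

end C047

end TriangleCap

end PercRepro
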